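import Summits.BirchSwinnertonDyer.Rank1Residual.Additive.RamifiedTwistTamagawa
import Summits.BirchSwinnertonDyer.Rank1Residual.Additive.GordRankZeroChiBranch
import HarnessLib

/-!
# `ord_p c_p(W) = 0` for the `p*`-twist `W` of a curve with GOOD reduction at ANY ODD prime `p` —
# the one binder of the quadratic-branch chain whose proof changes at `p = 3` (T-e2-p3 bookkeeping;
# tool theorem only; cell `bsd-potss`, typer cc-typer-5)

HONEST FRAMING (cell `bsd-potss`, `run/shared/lean/pub/bsd-potss/`, FULL-BSD rank-`≤ 1` programme
tranche 1b; typed against cell `b2b-bsdres`'s quadratic-branch chain of class O10 / Gss2,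
`Additive/QuadraticBranchOddStrictExactControlDischarge.lean` §0): THEOREMS ONLY — no definition,
no Literature fact, no `sorry`, axioms standard; nothing about any class is asserted or booked.

## What and why

The rank-one signed chain on the quadratic branch (x1b's files, consumer
`Additive.bsdp_of_quadraticBranchPAdicGrossZagierValuation_of_exactControl`, discharge
`Additive.LevelBridge.quadraticBranchOddStrictExactControlOfPlusMCAt_of_readings`) and the cell's
even twin (T-e2-r0, seat `-ctrl`) are typed for `5 ≤ p`. The planner's item **T-e2-p3**
(`pub/bsd-potss/TARGET.md` v2 §1.1) asks which binders change on the `p = 3` share of Gss2 (O5a,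
`W = V ⊗ χ₋₃`, `a₃(V) = 0`). Reading the chain: `5 ≤ p` is USED in exactly one place — §0 of the
discharge file, `padicValNat_localTamagawaNumber_eq_zero_of_quadraticTwist_signedPrime (hp5 : 5 ≤ p)`,
which gets `ord_p c_p(W) = 0` from the Kodaira–Néron bound `c_p ≤ 4 < p` off split multiplicative
reduction. At `p = 3` that bound does not decide (`c = 4 > 3`), but the finer statement does: the
twist of a curve with GOOD reduction at an odd `p` by `±p` has Kodaira type `I₀*` at `p`, so
`c_p ∈ {1, 2, 4}` (Tate's algorithm, Step 6) and `p ∤ c_p` for EVERY odd `p` — in the kernel as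
additive-p4's `tamagawaNumberAt_twist_of_semistable_mem` / `not_dvd_tamagawaNumberAt_twist_pm_p`
(`Additive/RamifiedTwistTamagawa.lean`). This file re-states that fact in the exact currency and
binder shape of the chain's §0 lemma (`Cv • W.quadraticTwist ((−1)^{⌊p/2⌋} p) = V`, `V` good at `p`,
conclusion on `localTamagawaNumber` of `W` over the completion at the place of `𝓞 ℚ` over `p`), with
`p ≠ 2` in place of `5 ≤ p`:

* `padicValNat_localTamagawaNumber_eq_zero_of_quadraticTwist_signedPrime_of_odd` — drop-in
  replacement for the `hp5` lemma at every odd `p`; so on the `a₃(V) = 0` sub-share of O5a the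
  remaining `5 ≤ p` binders of the chain are the ones written INTO the typed nodes
  ((C3_η) `QuadraticBranchOddStrictExactControlOfPlusMCAt`, (C2_η-GZ)
  `QuadraticBranchPAdicGrossZagierValuationAt`, `QuadraticBranchMinusLeadingValuationAt`), i.e. a
  re-typing decision (planner / class lead), not a missing proof; the `a₃(V) = ±3` sub-share
  (Sprung's `♯/♭` theory) is outside the `a_p(V) = 0` binder and is not touched.
* `tamagawaNumberAt_mem_of_quadraticTwist_signedPrime_of_odd` — the underlying `c_p(W) ∈ {1, 2, 4}`.

References: J. H. Silverman, *Advanced Topics*, GTM 151 (1994), IV.9.4 Steps 6–7 and Table 4.1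
[SilvermanATAEC1994]; J. H. Silverman, *AEC*, GTM 106 (2009), VII.6 Thm. 6.1 and X.5 Cor. 5.4
[SilvermanAEC2009].
-/

noncomputable section

open scoped Classical

open IsDedekindDomain IsDedekindDomain.HeightOneSpectrum NumberField Rat.HeightOneSpectrum
  WeierstrassCurve Literature.NumberTheory.EllipticCurves
  Literature.NumberTheory.EllipticCurves.Rank1Residual

namespace Summit.BirchSwinnertonDyer.Rank1Residual.Additive

variable (W : WeierstrassCurve ℚ) [W.IsElliptic] (p : ℕ) [hp : Fact p.Prime]

omit [W.IsElliptic] hp in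
/-- `p* = (−1)^{⌊p/2⌋}·p` is `p` or `−p`. [folklore] -/
theorem signedPrime_eq_or : ((-1 : ℚ) ^ (p / 2) * p) = p ∨ ((-1 : ℚ) ^ (p / 2) * p) = -p := by
  rcases neg_one_pow_eq_or ℚ (p / 2) with h | h
  · exact Or.inl (by rw [h, one_mul])
  · exact Or.inr (by rw [h, neg_one_mul])

/-- **`c_p(W) ∈ {1, 2, 4}` for the `p*`-twist `W` of a curve `V` with good reduction at the odd
prime `p`** (`Cv • W^{(p*)} = V` globally minimal and good at `p`; Kodaira type `I₀*` at `p`): the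
twist involution on models (`exists_variableChange_twist_of_model_twist`: `W ≅ C • V^{(p*)}`) and
additive-p4's `tamagawaNumberAt_twist_pm_p_mem`.
[cite: SilvermanATAEC1994, IV.9.4 Step 6 and Table 4.1 (PDF pp. 345–346)] [cite: SilvermanAEC2009, X.5 Cor. 5.4] -/
theorem tamagawaNumberAt_mem_of_quadraticTwist_signedPrime_of_odd (hp2 : p ≠ 2)
    (Cv : VariableChange ℚ) (V : WeierstrassCurve ℚ) [V.IsElliptic] [V.IsGloballyMinimal]
    (hCV : Cv • W.quadraticTwist ((-1) ^ (p / 2) * p) = V) (hgood : V.HasGoodReductionAtPrime p) :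
    W.tamagawaNumberAt ((primesEquiv (R := 𝓞 ℚ)).symm ⟨p, hp.out⟩) = 1 ∨
      W.tamagawaNumberAt ((primesEquiv (R := 𝓞 ℚ)).symm ⟨p, hp.out⟩) = 2 ∨
      W.tamagawaNumberAt ((primesEquiv (R := 𝓞 ℚ)).symm ⟨p, hp.out⟩) = 4 := by
  have hd0 : ((-1 : ℚ) ^ (p / 2) * p) ≠ 0 :=
    mul_ne_zero (pow_ne_zero _ (by norm_num)) (by exact_mod_cast hp.out.ne_zero)
  obtain ⟨C, hC⟩ := exists_variableChange_twist_of_model_twist W hd0 hCV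
  exact tamagawaNumberAt_twist_pm_p_mem p hp2 V (Or.inl hgood) (signedPrime_eq_or p) C hC

/-- **`ord_p c_p(W) = 0` for the `p*`-twist `W` of a curve `V` with good reduction at ANY ODD
prime `p`** — the drop-in replacement, with `p ≠ 2` in place of `5 ≤ p`, of §0's
`padicValNat_localTamagawaNumber_eq_zero_of_quadraticTwist_signedPrime` of
`QuadraticBranchOddStrictExactControlDischarge.lean` (same binders, same `localTamagawaNumber`
currency at the place of `𝓞 ℚ` over `p`): `c_p(W) ∈ {1, 2, 4}` is prime to every odd `p`, in
particular to `p = 3` (types `IV`, `IV*` with `c = 3` do not occur for the twist of a good curve).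
[cite: SilvermanATAEC1994, IV.9.4 Step 6 and Table 4.1 (PDF pp. 345–346)] [cite: SilvermanAEC2009, VII.6 Thm. 6.1] -/
theorem padicValNat_localTamagawaNumber_eq_zero_of_quadraticTwist_signedPrime_of_odd (hp2 : p ≠ 2)
    (Cv : VariableChange ℚ) (V : WeierstrassCurve ℚ) [V.IsElliptic] [V.IsGloballyMinimal]
    (hCV : Cv • W.quadraticTwist ((-1) ^ (p / 2) * p) = V) (hgood : V.HasGoodReductionAtPrime p) :
    padicValNat p ((W.baseChange
        (((primesEquiv (R := 𝓞 ℚ)).symm ⟨p, hp.out⟩).adicCompletion ℚ)).localTamagawaNumber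
      (((primesEquiv (R := 𝓞 ℚ)).symm ⟨p, hp.out⟩).adicCompletionIntegers ℚ)) = 0 := by
  have hd0 : ((-1 : ℚ) ^ (p / 2) * p) ≠ 0 :=
    mul_ne_zero (pow_ne_zero _ (by norm_num)) (by exact_mod_cast hp.out.ne_zero)
  obtain ⟨C, hC⟩ := exists_variableChange_twist_of_model_twist W hd0 hCV
  have h := not_dvd_tamagawaNumberAt_twist_pm_p p hp2 V (Or.inl hgood) (signedPrime_eq_or p) C hC
  rw [tamagawaNumberAt_def] at h
  exact padicValNat.eq_zero_of_not_dvd h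

end Summit.BirchSwinnertonDyer.Rank1Residual.Additive

end
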